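import Mathlib.Analysis.PSeries
import Literature.MathematicalPhysics.StatisticalMechanics.LayerSumDecay
import HarnessLib

/-!
# Decay and tails of the Lennard-Jones interlayer couplings `J_k(a, h)`

From the layer-sum decay `|Φ_δ(k; a, h)| ≤ C |k|⁻⁴` (`LayerSumDecay.lean`) we derive, uniformly on
quadrants `a ≥ a₁ > 0`, `h ≥ h₁ > 0`:

* `abs_barlowCoupling_lennardJones_le` — `|J_k(a,h)| ≤ 2 C k⁻⁴` (`k ≠ 0`),
  `C = 10 (h₁⁻⁶/12 + 1/6)(h₁⁻⁶ + a₁⁻² h₁⁻⁴)`;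
* `sum_inv_pow_four_tail_le` — the elementary tail bound `∑_{k=K+1}^{K+n} k⁻⁴ ≤ (4/3) K⁻³` (`K ≥ 1`,
  telescoping `1/k⁴ ≤ (4/3)(t(k) − t(k+1))`, `t(k) = 1/((k−1)k(k+1))`);
* `summable_abs_barlowCoupling_lennardJones_tail`, `tsum_abs_barlowCoupling_lennardJones_tail_le` —
  the range-`K` tail `∑_{k > K} |J_k(a,h)| ≤ (8/3) C K⁻³`.

These are the typed "tails with a rate" used by truncated (range-`K`) Hägg-chain energy ledgers.
[folklore]
-/

noncomputable section

open Finset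

namespace Literature.MathematicalPhysics.StatisticalMechanics

/-- **`|J_k(a,h)| ≤ 2 C k⁻⁴`** uniformly on the quadrant `a ≥ a₁ > 0`, `h ≥ h₁ > 0`. [folklore] -/
theorem abs_barlowCoupling_lennardJones_le {a₁ h₁ : ℝ} (ha₁ : 0 < a₁) (hh₁ : 0 < h₁) {a h : ℝ}
    (ha : a₁ ≤ a) (hh : h₁ ≤ h) {k : ℕ} (hk : k ≠ 0) :
    |barlowCoupling lennardJones a h k| ≤
      2 * (10 * (h₁⁻¹ ^ 6 / 12 + 1 / 6) * (h₁⁻¹ ^ 6 + a₁⁻¹ ^ 2 * h₁⁻¹ ^ 4)) * ((k : ℝ) ^ 4)⁻¹ := by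
  have hk' : (k : ℤ) ≠ 0 := by exact_mod_cast hk
  have h0 := abs_layerInteraction_lennardJones_le ha₁ hh₁ ha hh 0 hk'
  have h1 := abs_layerInteraction_lennardJones_le ha₁ hh₁ ha hh 1 hk'
  have hcast : ((|((k : ℤ) : ℝ)|) ^ 4)⁻¹ = ((k : ℝ) ^ 4)⁻¹ := by
    rw [Int.cast_natCast, Nat.abs_cast]
  rw [hcast] at h0 h1
  unfold barlowCoupling
  calc |layerInteraction lennardJones a h 0 k - layerInteraction lennardJones a h 1 k|
      ≤ |layerInteraction lennardJones a h 0 k| + |layerInteraction lennardJones a h 1 k| :=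
        abs_sub _ _
    _ ≤ _ := by linarith

/-- Telescoping step: for `k ≥ 2`, `k⁻⁴ ≤ (4/3) (t(k) − t(k+1))` with `t(k) = ((k−1) k (k+1))⁻¹`.
[folklore] -/
theorem inv_pow_four_le_telescope {k : ℕ} (hk : 2 ≤ k) :
    ((k : ℝ) ^ 4)⁻¹ ≤ 4 / 3 * ((((k : ℝ) - 1) * k * (k + 1))⁻¹ - (((k : ℝ) * (k + 1) * (k + 2)))⁻¹) := by
  have hk2 : (2 : ℝ) ≤ k := by exact_mod_cast hk
  have hkm : 0 < (k : ℝ) - 1 := by linarith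
  have hkpos : 0 < (k : ℝ) := by linarith
  have e : (((k : ℝ) - 1) * k * (k + 1))⁻¹ - ((k : ℝ) * (k + 1) * (k + 2))⁻¹ =
      3 / (((k : ℝ) - 1) * k * (k + 1) * (k + 2)) := by
    field_simp
    ring
  rw [e, show 4 / 3 * (3 / (((k : ℝ) - 1) * k * (k + 1) * (k + 2))) =
      4 / (((k : ℝ) - 1) * k * (k + 1) * (k + 2)) by ring]
  rw [inv_eq_one_div, div_le_div_iff₀ (by positivity) (by positivity), one_mul]
  -- `(k-1) k (k+1) (k+2) ≤ 4 k⁴`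
  nlinarith [mul_pos hkpos hkpos, mul_pos (mul_pos hkpos hkpos) hkpos,
    mul_pos (mul_pos hkpos hkpos) (mul_pos hkpos hkpos)]

/-- **Tail of `∑ k⁻⁴`**: `∑_{k=K+1}^{K+n} k⁻⁴ ≤ (4/3) K⁻³` for `K ≥ 1`. [folklore] -/
theorem sum_inv_pow_four_tail_le {K : ℕ} (hK : 1 ≤ K) (n : ℕ) :
    ∑ k ∈ Finset.range n, (((k + K + 1 : ℕ) : ℝ) ^ 4)⁻¹ ≤ 4 / 3 * ((K : ℝ) ^ 3)⁻¹ := by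
  set t : ℕ → ℝ := fun k => ((((k : ℝ) - 1) * k * (k + 1)))⁻¹ with ht
  have hK1 : (1 : ℝ) ≤ K := by exact_mod_cast hK
  have hstep : ∀ k ∈ Finset.range n, (((k + K + 1 : ℕ) : ℝ) ^ 4)⁻¹ ≤
      4 / 3 * (t (k + K + 1) - t (k + K + 1 + 1)) := by
    intro k _
    have h := inv_pow_four_le_telescope (k := k + K + 1) (by omega)
    simp only [ht]
    push_cast at h ⊢
    convert h using 3; ring
  have htel : ∑ k ∈ Finset.range n, (t (k + K + 1) - t (k + K + 1 + 1)) =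
      t (K + 1) - t (n + K + 1) := by
    have := Finset.sum_range_sub' (fun k => t (k + K + 1)) n
    simp only [zero_add] at this
    rw [← this]
    exact Finset.sum_congr rfl fun k _ => by ring_nf
  have htn : 0 ≤ t (n + K + 1) := by
    simp only [ht]; push_cast
    have hn0 : (0 : ℝ) ≤ n := n.cast_nonneg
    have h1 : 0 ≤ (n : ℝ) + K + 1 - 1 := by linarith
    have h2 : 0 ≤ ((n : ℝ) + K + 1 - 1) * ((n : ℝ) + K + 1) * ((n : ℝ) + K + 1 + 1) := by positivity
    exact inv_nonneg.2 h2
  have htK : t (K + 1) ≤ ((K : ℝ) ^ 3)⁻¹ := by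
    simp only [ht]; push_cast
    rw [show (K : ℝ) + 1 - 1 = K by ring]
    have hKpos : (0 : ℝ) < K := by linarith
    exact inv_anti₀ (by positivity) (by nlinarith [mul_pos hKpos hKpos])
  calc ∑ k ∈ Finset.range n, (((k + K + 1 : ℕ) : ℝ) ^ 4)⁻¹
      ≤ ∑ k ∈ Finset.range n, 4 / 3 * (t (k + K + 1) - t (k + K + 1 + 1)) := Finset.sum_le_sum hstep
    _ = 4 / 3 * (t (K + 1) - t (n + K + 1)) := by rw [← Finset.mul_sum, htel]
    _ ≤ 4 / 3 * ((K : ℝ) ^ 3)⁻¹ := by nlinarith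

/-- The range-`K` tail of `|J_k|` is summable (comparison with `2 C k⁻⁴`). [folklore] -/
theorem summable_abs_barlowCoupling_lennardJones_tail {a h : ℝ} (ha : 0 < a) (hh : 0 < h) (K : ℕ) :
    Summable fun k : ℕ => |barlowCoupling lennardJones a h (k + K + 1)| := by
  set C : ℝ := 2 * (10 * (h⁻¹ ^ 6 / 12 + 1 / 6) * (h⁻¹ ^ 6 + a⁻¹ ^ 2 * h⁻¹ ^ 4)) with hC
  have hbound : ∀ k : ℕ, |barlowCoupling lennardJones a h (k + K + 1)| ≤
      C * ((((k + K + 1 : ℕ) : ℝ)) ^ 4)⁻¹ := fun k =>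
    abs_barlowCoupling_lennardJones_le ha hh le_rfl le_rfl (k := k + K + 1) (by omega)
  refine Summable.of_nonneg_of_le (fun k => abs_nonneg _) hbound ?_
  refine Summable.mul_left C ?_
  have hs : Summable fun k : ℕ => (((k : ℕ) : ℝ) ^ 4)⁻¹ :=
    (Real.summable_nat_pow_inv (p := 4)).2 (by norm_num)
  exact (summable_nat_add_iff (K + 1)).2 hs |>.congr fun k => by
    show ((((k + (K + 1) : ℕ) : ℝ)) ^ 4)⁻¹ = _
    rw [← add_assoc]

/-- **Range-`K` tail of the couplings**: `∑_{k > K} |J_k(a,h)| ≤ (8/3) C K⁻³` uniformly on the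
quadrant `a ≥ a₁ > 0`, `h ≥ h₁ > 0` (`K ≥ 1`), `C = 10 (h₁⁻⁶/12 + 1/6)(h₁⁻⁶ + a₁⁻² h₁⁻⁴)`.
[folklore] -/
theorem tsum_abs_barlowCoupling_lennardJones_tail_le {a₁ h₁ : ℝ} (ha₁ : 0 < a₁) (hh₁ : 0 < h₁)
    {a h : ℝ} (ha : a₁ ≤ a) (hh : h₁ ≤ h) {K : ℕ} (hK : 1 ≤ K) :
    ∑' k : ℕ, |barlowCoupling lennardJones a h (k + K + 1)| ≤
      8 / 3 * (10 * (h₁⁻¹ ^ 6 / 12 + 1 / 6) * (h₁⁻¹ ^ 6 + a₁⁻¹ ^ 2 * h₁⁻¹ ^ 4)) * ((K : ℝ) ^ 3)⁻¹ := by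
  set C : ℝ := 10 * (h₁⁻¹ ^ 6 / 12 + 1 / 6) * (h₁⁻¹ ^ 6 + a₁⁻¹ ^ 2 * h₁⁻¹ ^ 4) with hC
  have hC0 : 0 ≤ C := by positivity
  have hsum := summable_abs_barlowCoupling_lennardJones_tail (ha₁.trans_le ha) (hh₁.trans_le hh) K
  refine hsum.tsum_le_of_sum_le fun F => ?_
  -- bound a finite partial sum by the sum over `range n ⊇ F`
  obtain ⟨n, hn⟩ : ∃ n, F ⊆ Finset.range n :=
    ⟨F.sup id + 1, fun k hk => Finset.mem_range.2 (Nat.lt_succ_of_le (Finset.le_sup (f := id) hk))⟩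
  calc ∑ k ∈ F, |barlowCoupling lennardJones a h (k + K + 1)|
      ≤ ∑ k ∈ Finset.range n, |barlowCoupling lennardJones a h (k + K + 1)| :=
        Finset.sum_le_sum_of_subset_of_nonneg hn fun k _ _ => abs_nonneg _
    _ ≤ ∑ k ∈ Finset.range n, 2 * C * ((((k + K + 1 : ℕ) : ℝ)) ^ 4)⁻¹ :=
        Finset.sum_le_sum fun k _ =>
          abs_barlowCoupling_lennardJones_le ha₁ hh₁ ha hh (k := k + K + 1) (by omega)
    _ = 2 * C * ∑ k ∈ Finset.range n, ((((k + K + 1 : ℕ) : ℝ)) ^ 4)⁻¹ := by rw [Finset.mul_sum]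
    _ ≤ 2 * C * (4 / 3 * ((K : ℝ) ^ 3)⁻¹) :=
        mul_le_mul_of_nonneg_left (sum_inv_pow_four_tail_le hK n) (by positivity)
    _ = 8 / 3 * C * ((K : ℝ) ^ 3)⁻¹ := by ring

end Literature.MathematicalPhysics.StatisticalMechanics

end
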